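import Literature.Combinatorics.SetFamily.KatonaIntersectingShadow
import Mathlib.Data.Nat.Factorial.Basic
import Mathlib.Tactic.Ring

/-!
# Katona's intersecting shadow theorem, `t`-intersecting form (Katona 1964), proved

Source: G. Katona, *Intersection theorems for systems of finite sets*, Acta Math. Acad. Sci. Hungar. **15** (1964)
329–337, Theorem 1, in the case of the shadow exactly `t` levels down: **if `𝒜` is a family of `k`-element sets any two
of which meet in at least `t` elements, then the family `∂^[t] 𝒜` of `(k-t)`-element subsets of members of `𝒜` has at
least `#𝒜` members.**  (Katona's Theorem 1 gives, for the `g`-shadow with `k - t ≤ g ≤ k`, the factor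
`C(2k-t, g)/C(2k-t, k)`; at `g = k - t` this factor is `1`.  The companion file `KatonaIntersectingShadow` is the case
`t = 1`; secondary source for that case: Anderson, *Combinatorics of Finite Sets*, Thm 5.5.3.)

## Proof formalised (shifting, as for `t = 1`)

Induction on the size `n` of a ground finset `s`, all `k` at once, `t` fixed.
* If `n ≤ 2k - t`: iterating the local LYM inequality gives `#𝒜 · k(k-1)⋯(k-t+1) ≤ #∂^[t]𝒜 · (n-k+t)⋯(n-k+1)`
  (`KatonaShadowT.card_mul_descFactorial_le`), and `k ≥ n - k + t` makes the first falling factorial the larger one.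
* If `n ≥ 2k - t + 1`: pass to a family compressed towards every `i ∈ s` (same size, `k`-uniform, `t`-intersecting —
  `KatonaShadowT.le_card_inter_compression` — and with no larger `t`-shadow — `KatonaShadowT.shadow_iterate_compression_subset`);
  split along `ℓ`; the sections `{B ∖ ℓ : ℓ ∈ B}` are again `t`-intersecting (`…le_card_inter_image_erase_of_isCompressed`:
  two members meeting in exactly `t` points including `ℓ` span `2k - t < n` points, and shifting one of them onto a free
  point lowers the intersection to `t - 1`); `∂^[t]ℬ ⊇ ∂^[t]ℬ₀ ⊔ (∂^[t]ℬ₁ + ℓ)`; induct.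

## Contents

* `card_le_card_shadow_iterate_of_sized_of_le_card_inter` — the theorem: `(𝒜 : Set _).Sized k`,
  `∀ A B ∈ 𝒜, t ≤ #(A ∩ B)` ⟹ `#𝒜 ≤ #(∂^[t] 𝒜)` (any `t`; for `t = 0` trivial, for `t > k` the family is empty).
-/

namespace Literature.Combinatorics.SetFamily

open Finset
open scoped FinsetFamily

variable {α : Type*} [DecidableEq α]

namespace KatonaShadowT

/-! ### Singleton `UV`-compression (the `(i,ℓ)`-shift): the facts needed here -/

/-- The shift of a set containing `ℓ` and avoiding `i` replaces `ℓ` by `i`. [folklore] -/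
private theorem compress_eq {i ℓ : α} {a : Finset α} (hℓ : ℓ ∈ a) (hi : i ∉ a) :
    UV.compress ({i} : Finset α) {ℓ} a = (a ∪ {i}) \ {ℓ} := by
  rw [UV.compress_of_disjoint_of_le (disjoint_singleton_left.2 hi) (singleton_subset_iff.2 hℓ), sup_eq_union]

/-- A set not containing `ℓ`, or containing `i`, is not moved by the shift. [folklore] -/
private theorem compress_eq_self {i ℓ : α} {a : Finset α} (h : ¬ (ℓ ∈ a ∧ i ∉ a)) :
    UV.compress ({i} : Finset α) {ℓ} a = a := by
  unfold UV.compress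
  rw [if_neg]
  rintro ⟨hd, hle⟩
  exact h ⟨singleton_subset_iff.1 hle, disjoint_singleton_left.1 hd⟩

/-- Membership in a shifted set. [folklore] -/
private theorem mem_compress_iff {i ℓ x : α} {a : Finset α} (hℓ : ℓ ∈ a) (hi : i ∉ a) :
    x ∈ UV.compress ({i} : Finset α) {ℓ} a ↔ (x ∈ a ∨ x = i) ∧ x ≠ ℓ := by
  rw [compress_eq hℓ hi, mem_sdiff, mem_union, mem_singleton, mem_singleton]

/-- For a moved set, the shift is `insert i (a.erase ℓ)`. [folklore] -/
private theorem compress_eq_insert_erase {i ℓ : α} {a : Finset α} (hℓ : ℓ ∈ a) (hi : i ∉ a) :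
    UV.compress ({i} : Finset α) {ℓ} a = insert i (a.erase ℓ) := by
  ext x
  rw [mem_compress_iff hℓ hi, mem_insert, mem_erase]
  constructor
  · rintro ⟨h | h, hne⟩
    · exact Or.inr ⟨hne, h⟩
    · exact Or.inl h
  · rintro (h | ⟨hne, h⟩)
    · exact ⟨Or.inr h, fun hx => hi (by rw [← h, hx]; exact hℓ)⟩
    · exact ⟨Or.inl h, hne⟩

/-- Every member of the shifted family is an old member or the shift of an old member that was moved out. [folklore] -/
private theorem mem_compression_cases {i ℓ : α} {𝒜 : Finset (Finset α)} {a : Finset α}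
    (ha : a ∈ 𝓒 ({i} : Finset α) {ℓ} 𝒜) :
    a ∈ 𝒜 ∨ ∃ b ∈ 𝒜, (ℓ ∈ b ∧ i ∉ b) ∧ UV.compress ({i} : Finset α) {ℓ} b ∉ 𝒜 ∧
      a = UV.compress ({i} : Finset α) {ℓ} b := by
  rw [UV.mem_compression] at ha
  rcases ha with ⟨ha, -⟩ | ⟨hna, b, hb, hba⟩
  · exact Or.inl ha
  · right
    refine ⟨b, hb, ?_, ?_, hba.symm⟩
    · by_contra h
      rw [compress_eq_self h] at hba
      exact hna (hba ▸ hb)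
    · rwa [hba]

/-- An old member that survives in the shifted family has its shift in the old family. [folklore] -/
private theorem compress_mem_of_mem_of_mem_compression {i ℓ : α} {𝒜 : Finset (Finset α)} {a : Finset α}
    (ha : a ∈ 𝓒 ({i} : Finset α) {ℓ} 𝒜) (ha𝒜 : a ∈ 𝒜) : UV.compress ({i} : Finset α) {ℓ} a ∈ 𝒜 := by
  rw [UV.mem_compression] at ha
  rcases ha with ⟨-, h⟩ | ⟨hna, -⟩
  · exact h
  · exact (hna ha𝒜).elim

/-- Shifting along `i ∈ s` keeps a family inside the ground set `s`. [folklore] -/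
private theorem subset_of_mem_compression {i ℓ : α} {s : Finset α} (hi : i ∈ s) {𝒜 : Finset (Finset α)}
    (h𝒜 : ∀ a ∈ 𝒜, a ⊆ s) : ∀ a ∈ 𝓒 ({i} : Finset α) {ℓ} 𝒜, a ⊆ s := by
  intro a ha
  rcases mem_compression_cases ha with ha | ⟨b, hb, hbℓ, -, rfl⟩
  · exact h𝒜 a ha
  · rw [compress_eq_insert_erase hbℓ.1 hbℓ.2]
    exact insert_subset hi ((erase_subset ℓ b).trans (h𝒜 b hb))

/-- A non-trivial `(i,ℓ)`-shift strictly decreases the number of members containing `ℓ`. [folklore] -/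
private theorem card_filter_mem_compression_lt {i ℓ : α} {𝒜 : Finset (Finset α)}
    (h : 𝓒 ({i} : Finset α) {ℓ} 𝒜 ≠ 𝒜) :
    #((𝓒 ({i} : Finset α) {ℓ} 𝒜).filter fun a => ℓ ∈ a) < #(𝒜.filter fun a => ℓ ∈ a) := by
  have hex : ∃ a ∈ 𝒜, UV.compress ({i} : Finset α) {ℓ} a ∉ 𝒜 := by
    by_contra hall
    push Not at hall
    refine h (ext fun a => ?_)
    rw [UV.mem_compression]
    refine ⟨?_, fun ha => Or.inl ⟨ha, hall a ha⟩⟩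
    rintro (⟨ha, -⟩ | ⟨-, b, hb, rfl⟩)
    · exact ha
    · exact hall b hb
  obtain ⟨a, ha, hca⟩ := hex
  have hℓa : ℓ ∈ a ∧ i ∉ a := by_contra fun hn => by rw [compress_eq_self hn] at hca; exact hca ha
  have hsub : ((𝓒 ({i} : Finset α) {ℓ} 𝒜).filter fun a => ℓ ∈ a) ⊆ 𝒜.filter fun a => ℓ ∈ a := by
    intro x hx
    rw [mem_filter] at hx ⊢
    rcases mem_compression_cases hx.1 with hx𝒜 | ⟨b, -, hbℓ, -, rfl⟩
    · exact ⟨hx𝒜, hx.2⟩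
    · exact absurd hx.2 (by rw [mem_compress_iff hbℓ.1 hbℓ.2]; exact fun h => h.2 rfl)
  refine card_lt_card ((ssubset_iff_of_subset hsub).2 ⟨a, mem_filter.2 ⟨ha, hℓa.1⟩, fun hmem => ?_⟩)
  rcases UV.mem_compression.1 (mem_filter.1 hmem).1 with ⟨-, hc⟩ | ⟨hna, -⟩
  · exact hca hc
  · exact hna ha

/-- `#ℬ = #{B : ℓ ∉ B} + #{B ∖ ℓ : ℓ ∈ B}`. [folklore] -/
private theorem card_split (ℬ : Finset (Finset α)) (ℓ : α) :
    #ℬ = #(ℬ.filter fun b => ℓ ∉ b) + #((ℬ.filter fun b => ℓ ∈ b).image fun b => b.erase ℓ) := by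
  rw [card_image_of_injOn, add_comm, card_filter_add_card_filter_not]
  intro b hb b' hb' h
  have h' : b.erase ℓ = b'.erase ℓ := h
  rw [← insert_erase (mem_filter.1 hb).2, h', insert_erase (mem_filter.1 hb').2]

/-! ### Shifting preserves `t`-intersection -/

/-- The `(i,ℓ)`-shift of a `t`-intersecting family is `t`-intersecting. [folklore] -/
private theorem le_card_inter_compression {i ℓ : α} {t : ℕ} {𝒜 : Finset (Finset α)}
    (h𝒜 : ∀ a ∈ 𝒜, ∀ b ∈ 𝒜, t ≤ #(a ∩ b)) :
    ∀ a ∈ 𝓒 ({i} : Finset α) {ℓ} 𝒜, ∀ b ∈ 𝓒 ({i} : Finset α) {ℓ} 𝒜, t ≤ #(a ∩ b) := by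
  -- key asymmetric step: `a`, `compress a ∈ 𝒜`, `b₀ ∈ 𝒜` moved
  have key : ∀ a ∈ 𝒜, UV.compress ({i} : Finset α) {ℓ} a ∈ 𝒜 → ∀ b₀ ∈ 𝒜, ℓ ∈ b₀ → i ∉ b₀ →
      t ≤ #(a ∩ UV.compress ({i} : Finset α) {ℓ} b₀) := by
    intro a ha hca b₀ hb₀ hℓb hib
    rw [compress_eq_insert_erase hℓb hib]
    by_cases hℓa : ℓ ∈ a
    · by_cases hia : i ∈ a
      · -- `a ∩ insert i (b₀.erase ℓ) = insert i ((a ∩ b₀).erase ℓ)`: same size as `a ∩ b₀`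
        have e : a ∩ insert i (b₀.erase ℓ) = insert i ((a ∩ b₀).erase ℓ) := by
          ext x; simp only [mem_inter, mem_insert, mem_erase]; constructor
          · rintro ⟨hxa, rfl | ⟨hne, hxb⟩⟩
            · exact Or.inl rfl
            · exact Or.inr ⟨hne, hxa, hxb⟩
          · rintro (rfl | ⟨hne, hxa, hxb⟩)
            · exact ⟨hia, Or.inl rfl⟩
            · exact ⟨hxa, Or.inr ⟨hne, hxb⟩⟩
        rw [e, card_insert_of_notMem (fun h => hib (mem_inter.1 (mem_erase.1 h).2).2),
          card_erase_of_mem (mem_inter.2 ⟨hℓa, hℓb⟩)]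
        have := h𝒜 a ha b₀ hb₀
        have hpos : 0 < #(a ∩ b₀) := card_pos.2 ⟨ℓ, mem_inter.2 ⟨hℓa, hℓb⟩⟩
        omega
      · -- `compress a = insert i (a.erase ℓ) ∈ 𝒜` meets `b₀` in `#(a ∩ b₀) - 1 ≥ t` points
        have hca' : insert i (a.erase ℓ) ∈ 𝒜 := by rwa [compress_eq_insert_erase hℓa hia] at hca
        have h1 := h𝒜 _ hca' b₀ hb₀
        have e1 : insert i (a.erase ℓ) ∩ b₀ = (a ∩ b₀).erase ℓ := by
          ext x; simp only [mem_inter, mem_insert, mem_erase]; constructor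
          · rintro ⟨rfl | ⟨hne, hxa⟩, hxb⟩
            · exact (hib hxb).elim
            · exact ⟨hne, hxa, hxb⟩
          · rintro ⟨hne, hxa, hxb⟩
            exact ⟨Or.inr ⟨hne, hxa⟩, hxb⟩
        have e2 : a ∩ insert i (b₀.erase ℓ) = (a ∩ b₀).erase ℓ := by
          ext x; simp only [mem_inter, mem_insert, mem_erase]; constructor
          · rintro ⟨hxa, rfl | ⟨hne, hxb⟩⟩
            · exact (hia hxa).elim
            · exact ⟨hne, hxa, hxb⟩
          · rintro ⟨hne, hxa, hxb⟩
            exact ⟨hxa, Or.inr ⟨hne, hxb⟩⟩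
        rw [e2]; rwa [e1] at h1
    · -- `ℓ ∉ a`: `a ∩ b₀ ⊆ a ∩ insert i (b₀.erase ℓ)`
      refine (h𝒜 a ha b₀ hb₀).trans (card_le_card fun x hx => ?_)
      obtain ⟨hxa, hxb⟩ := mem_inter.1 hx
      exact mem_inter.2 ⟨hxa, mem_insert_of_mem (mem_erase.2 ⟨fun h => hℓa (h ▸ hxa), hxb⟩)⟩
  intro a ha b hb
  rcases mem_compression_cases ha with ha𝒜 | ⟨a₀, ha₀, ha₀ℓ, -, rfl⟩
  · rcases mem_compression_cases hb with hb𝒜 | ⟨b₀, hb₀, hb₀ℓ, -, rfl⟩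
    · exact h𝒜 a ha𝒜 b hb𝒜
    · exact key a ha𝒜 (compress_mem_of_mem_of_mem_compression ha ha𝒜) b₀ hb₀ hb₀ℓ.1 hb₀ℓ.2
  · rcases mem_compression_cases hb with hb𝒜 | ⟨b₀, hb₀, hb₀ℓ, -, rfl⟩
    · rw [inter_comm]
      exact key b hb𝒜 (compress_mem_of_mem_of_mem_compression hb hb𝒜) a₀ ha₀ ha₀ℓ.1 ha₀ℓ.2
    · -- both moved: the intersection is `insert i ((a₀ ∩ b₀).erase ℓ)`, of the same size as `a₀ ∩ b₀`
      rw [compress_eq_insert_erase ha₀ℓ.1 ha₀ℓ.2, compress_eq_insert_erase hb₀ℓ.1 hb₀ℓ.2]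
      have e : insert i (a₀.erase ℓ) ∩ insert i (b₀.erase ℓ) = insert i ((a₀ ∩ b₀).erase ℓ) := by
        ext x; simp only [mem_inter, mem_insert, mem_erase]; tauto
      rw [e, card_insert_of_notMem (fun h => ha₀ℓ.2 (mem_inter.1 (mem_erase.1 h).2).1),
        card_erase_of_mem (mem_inter.2 ⟨ha₀ℓ.1, hb₀ℓ.1⟩)]
      have := h𝒜 a₀ ha₀ b₀ hb₀
      have hpos : 0 < #(a₀ ∩ b₀) := card_pos.2 ⟨ℓ, mem_inter.2 ⟨ha₀ℓ.1, hb₀ℓ.1⟩⟩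
      omega

/-! ### Shifting does not increase iterated shadows -/

/-- `∂^[t] (𝓒 𝒜) ⊆ 𝓒 (∂^[t] 𝒜)` for singleton compressions (iterate Mathlib's one-step lemma). [folklore] -/
private theorem shadow_iterate_compression_subset (i ℓ : α) (t : ℕ) (𝒜 : Finset (Finset α)) :
    ∂^[t] (𝓒 ({i} : Finset α) {ℓ} 𝒜) ⊆ 𝓒 ({i} : Finset α) {ℓ} (∂^[t] 𝒜) := by
  have huv : ∀ ℬ : Finset (Finset α), ∀ x ∈ ({i} : Finset α), ∃ y ∈ ({ℓ} : Finset α),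
      UV.IsCompressed (({i} : Finset α).erase x) (({ℓ} : Finset α).erase y) ℬ := by
    intro ℬ x hx
    refine ⟨ℓ, mem_singleton_self ℓ, ?_⟩
    rw [mem_singleton.1 hx, erase_singleton, erase_singleton]
    exact UV.isCompressed_self _ _
  induction t with
  | zero => exact subset_rfl
  | succ t ih =>
    rw [Function.iterate_succ_apply', Function.iterate_succ_apply']
    exact (shadow_mono ih).trans (UV.shadow_compression_subset_compression_shadow _ _ (huv _))

/-- Shifting does not increase the `t`-fold shadow. [folklore] -/
private theorem card_shadow_iterate_compression_le (i ℓ : α) (t : ℕ) (𝒜 : Finset (Finset α)) :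
    #(∂^[t] (𝓒 ({i} : Finset α) {ℓ} 𝒜)) ≤ #(∂^[t] 𝒜) :=
  (card_le_card (shadow_iterate_compression_subset i ℓ t 𝒜)).trans (UV.card_compression _ _ _).le

/-! ### Reaching a compressed family -/

/-- From a `k`-uniform `t`-intersecting family inside `s` one reaches, by `(i,ℓ)`-shifts, a family of the same size inside `s`,
`k`-uniform, `t`-intersecting, with no larger `t`-fold shadow, compressed towards every `i ∈ s`. [folklore] -/
private theorem exists_compressed (s : Finset α) (ℓ : α) (k t : ℕ) :
    ∀ (m : ℕ) (𝒜 : Finset (Finset α)), #(𝒜.filter fun a => ℓ ∈ a) ≤ m →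
      (∀ a ∈ 𝒜, a ⊆ s) → (𝒜 : Set (Finset α)).Sized k → (∀ a ∈ 𝒜, ∀ b ∈ 𝒜, t ≤ #(a ∩ b)) →
      ∃ ℬ : Finset (Finset α), (∀ b ∈ ℬ, b ⊆ s) ∧ #ℬ = #𝒜 ∧ (ℬ : Set (Finset α)).Sized k ∧
        (∀ a ∈ ℬ, ∀ b ∈ ℬ, t ≤ #(a ∩ b)) ∧ #(∂^[t] ℬ) ≤ #(∂^[t] 𝒜) ∧
        ∀ i ∈ s, UV.IsCompressed ({i} : Finset α) {ℓ} ℬ := by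
  intro m
  induction m with
  | zero =>
    intro 𝒜 hm hs hk hI
    by_cases hall : ∀ i ∈ s, UV.IsCompressed ({i} : Finset α) {ℓ} 𝒜
    · exact ⟨𝒜, hs, rfl, hk, hI, le_rfl, hall⟩
    · push Not at hall
      obtain ⟨i, -, hne⟩ := hall
      exact absurd ((card_filter_mem_compression_lt hne).trans_le hm) (Nat.not_lt_zero _)
  | succ m ih =>
    intro 𝒜 hm hs hk hI
    by_cases hall : ∀ i ∈ s, UV.IsCompressed ({i} : Finset α) {ℓ} 𝒜
    · exact ⟨𝒜, hs, rfl, hk, hI, le_rfl, hall⟩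
    · push Not at hall
      obtain ⟨i, hi, hne⟩ := hall
      have hlt := card_filter_mem_compression_lt hne
      obtain ⟨ℬ, hℬs, hℬcard, hℬk, hℬI, hℬsh, hℬc⟩ :=
        ih (𝓒 ({i} : Finset α) {ℓ} 𝒜) (by omega) (subset_of_mem_compression hi hs)
          (hk.uvCompression (by rw [card_singleton, card_singleton])) (le_card_inter_compression hI)
      exact ⟨ℬ, hℬs, hℬcard.trans (UV.card_compression _ _ _), hℬk, hℬI,
        hℬsh.trans (card_shadow_iterate_compression_le i ℓ t 𝒜), hℬc⟩

/-! ### Splitting along `ℓ` -/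

/-- `∂^[t]ℬ ⊇ ∂^[t]{B : ℓ ∉ B} ⊔ {E ∪ {ℓ} : E ∈ ∂^[t]{B ∖ {ℓ} : ℓ ∈ B}}`, as a cardinality inequality. [folklore] -/
private theorem card_shadow_iterate_split (ℬ : Finset (Finset α)) (ℓ : α) (t : ℕ) :
    #(∂^[t] (ℬ.filter fun b => ℓ ∉ b)) + #(∂^[t] ((ℬ.filter fun b => ℓ ∈ b).image fun b => b.erase ℓ)) ≤
      #(∂^[t] ℬ) := by
  set ℬ₀ := ℬ.filter fun b => ℓ ∉ b with hℬ₀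
  set ℬ₁ := (ℬ.filter fun b => ℓ ∈ b).image fun b => b.erase ℓ with hℬ₁
  have h0 : ∂^[t] ℬ₀ ⊆ ∂^[t] ℬ := shadow_monotone.iterate t (filter_subset _ _)
  have hℓ0 : ∀ e ∈ ∂^[t] ℬ₀, ℓ ∉ e := fun e he h => by
    obtain ⟨b, hb, hsub, -⟩ := mem_shadow_iterate_iff_exists_sdiff.1 he
    exact (mem_filter.1 hb).2 (hsub h)
  have hℓ1 : ∀ e ∈ ∂^[t] ℬ₁, ℓ ∉ e := fun e he h => by
    obtain ⟨b, hb, hsub, -⟩ := mem_shadow_iterate_iff_exists_sdiff.1 he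
    obtain ⟨c, -, rfl⟩ := mem_image.1 hb
    exact (notMem_erase ℓ c) (hsub h)
  have h1 : (∂^[t] ℬ₁).image (insert ℓ) ⊆ ∂^[t] ℬ := by
    intro u hu
    obtain ⟨e, he, rfl⟩ := mem_image.1 hu
    have hℓe := hℓ1 e he
    obtain ⟨b', hb', hsub, hcard⟩ := mem_shadow_iterate_iff_exists_sdiff.1 he
    obtain ⟨b, hb, rfl⟩ := mem_image.1 hb'
    have hbℓ : ℓ ∈ b := (mem_filter.1 hb).2
    refine mem_shadow_iterate_iff_exists_sdiff.2 ⟨b, (mem_filter.1 hb).1,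
      insert_subset hbℓ (hsub.trans (erase_subset ℓ b)), ?_⟩
    have e1 : b \ insert ℓ e = b.erase ℓ \ e := by
      ext x; simp only [mem_sdiff, mem_insert, mem_erase, not_or]; tauto
    rw [e1, hcard]
  have hdisj : Disjoint (∂^[t] ℬ₀) ((∂^[t] ℬ₁).image (insert ℓ)) := disjoint_left.2 fun e he he' => by
    obtain ⟨e', -, rfl⟩ := mem_image.1 he'
    exact hℓ0 _ he (mem_insert_self ℓ e')
  calc #(∂^[t] ℬ₀) + #(∂^[t] ℬ₁) = #(∂^[t] ℬ₀) + #((∂^[t] ℬ₁).image (insert ℓ)) := by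
        rw [card_image_of_injOn]
        intro e he e' he' h
        have h' : insert ℓ e = insert ℓ e' := h
        rw [← erase_insert (hℓ1 e he), h', erase_insert (hℓ1 e' he')]
    _ = #(∂^[t] ℬ₀ ∪ (∂^[t] ℬ₁).image (insert ℓ)) := (card_union_of_disjoint hdisj).symm
    _ ≤ #(∂^[t] ℬ) := card_le_card (union_subset h0 h1)

/-- The crux: for `ℬ` `k`-uniform, `t`-intersecting (`t ≥ 1`), `({i},{ℓ})`-compressed for every `i ∈ s`, with
`2k - t < #s`, the sections `{B ∖ {ℓ} : B ∈ ℬ, ℓ ∈ B}` are `t`-intersecting. [cite: Katona1964, Theorem 1] -/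
private theorem le_card_inter_image_erase_of_isCompressed {s : Finset α} {ℓ : α} {k t : ℕ}
    {ℬ : Finset (Finset α)} (hk : (ℬ : Set (Finset α)).Sized k)
    (hI : ∀ a ∈ ℬ, ∀ b ∈ ℬ, t ≤ #(a ∩ b))
    (hc : ∀ i ∈ s, UV.IsCompressed ({i} : Finset α) {ℓ} ℬ) (h2k : 2 * k + 1 ≤ #s + t) :
    ∀ a ∈ (ℬ.filter fun b => ℓ ∈ b).image (fun b => b.erase ℓ),
      ∀ b ∈ (ℬ.filter fun b => ℓ ∈ b).image (fun b => b.erase ℓ), t ≤ #(a ∩ b) := by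
  intro a ha b hb
  obtain ⟨A, hA, rfl⟩ := mem_image.1 ha
  obtain ⟨B, hB, rfl⟩ := mem_image.1 hb
  obtain ⟨hAℬ, hAℓ⟩ := mem_filter.1 hA
  obtain ⟨hBℬ, hBℓ⟩ := mem_filter.1 hB
  have eAB : A.erase ℓ ∩ B.erase ℓ = (A ∩ B).erase ℓ := by
    ext x; simp only [mem_inter, mem_erase]; tauto
  rw [eAB, card_erase_of_mem (mem_inter.2 ⟨hAℓ, hBℓ⟩)]
  by_contra hlt
  push Not at hlt
  -- `#(A ∩ B) = t` exactly, so `#(A ∪ B) = 2k - t < #s`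
  have hAB : #(A ∩ B) = t := by have := hI A hAℬ B hBℬ; omega
  have hcardU : #(A ∪ B) < #s := by
    have h1 : #(A ∪ B) + #(A ∩ B) = #A + #B := card_union_add_card_inter A B
    rw [hk hAℬ, hk hBℬ, hAB] at h1
    omega
  have hex : ∃ i ∈ s, i ∉ A ∪ B := by
    by_contra h
    push Not at h
    exact absurd (card_le_card (show s ⊆ A ∪ B from fun i hi => h i hi)) (not_le.2 hcardU)
  obtain ⟨i, hi, hiAB⟩ := hex
  rw [mem_union, not_or] at hiAB
  -- the shift of `B` is in `ℬ` and meets `A` in `t - 1` points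
  have hB' : UV.compress ({i} : Finset α) {ℓ} B ∈ ℬ := by
    have := UV.compress_mem_compression (u := ({i} : Finset α)) (v := {ℓ}) hBℬ
    rwa [(hc i hi).eq] at this
  have hle := hI A hAℬ _ hB'
  rw [compress_eq_insert_erase hBℓ hiAB.2] at hle
  have e2 : A ∩ insert i (B.erase ℓ) = (A ∩ B).erase ℓ := by
    ext x; simp only [mem_inter, mem_insert, mem_erase]; constructor
    · rintro ⟨hxa, rfl | ⟨hne, hxb⟩⟩
      · exact (hiAB.1 hxa).elim
      · exact ⟨hne, hxa, hxb⟩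
    · rintro ⟨hne, hxa, hxb⟩
      exact ⟨hxa, Or.inr ⟨hne, hxb⟩⟩
  rw [e2, card_erase_of_mem (mem_inter.2 ⟨hAℓ, hBℓ⟩), hAB] at hle
  omega

/-! ### Iterated local LYM inequality relative to a ground finset -/

/-- Local LYM relative to a ground finset `s` (one step). [folklore] -/
private theorem card_mul_le_card_shadow_mul {s : Finset α} {k : ℕ} {𝒜 : Finset (Finset α)}
    (hs : ∀ a ∈ 𝒜, a ⊆ s) (hk : (𝒜 : Set (Finset α)).Sized k) :
    #𝒜 * k ≤ #(∂ 𝒜) * (#s + 1 - k) := by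
  refine card_mul_le_card_mul (fun a e => e ⊆ a) (fun a ha => ?_) (fun e he => ?_)
  · have hsub : a.image (fun x => a.erase x) ⊆ (∂ 𝒜).bipartiteAbove (fun a e => e ⊆ a) a := by
      intro e he
      obtain ⟨x, hx, rfl⟩ := mem_image.1 he
      exact (mem_bipartiteAbove _).2 ⟨erase_mem_shadow ha hx, erase_subset x a⟩
    calc k = #a := (hk ha).symm
      _ = #(a.image fun x => a.erase x) := (card_image_of_injOn (erase_injOn a)).symm
      _ ≤ _ := card_le_card hsub
  · obtain ⟨a₀, ha₀, hea₀, hcard₀⟩ := mem_shadow_iff_exists_mem_card_add_one.1 he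
    have hek : #e + 1 = k := by rw [← hcard₀, hk ha₀]
    have hes : e ⊆ s := hea₀.trans (hs a₀ ha₀)
    have hsub : 𝒜.bipartiteBelow (fun a e => e ⊆ a) e ⊆ (s \ e).image fun x => insert x e := by
      intro a ha
      obtain ⟨ha𝒜, hea⟩ := (mem_bipartiteBelow _).1 ha
      have hcard : #(a \ e) = 1 := by rw [card_sdiff_of_subset hea, hk ha𝒜]; omega
      obtain ⟨x, hx⟩ := card_eq_one.1 hcard
      have hxmem : x ∈ a \ e := hx ▸ mem_singleton_self x
      refine mem_image.2 ⟨x, mem_sdiff.2 ⟨hs a ha𝒜 (mem_sdiff.1 hxmem).1, (mem_sdiff.1 hxmem).2⟩, ?_⟩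
      rw [insert_eq, ← hx, sdiff_union_of_subset hea]
    calc #(𝒜.bipartiteBelow (fun a e => e ⊆ a) e) ≤ #((s \ e).image fun x => insert x e) := card_le_card hsub
      _ ≤ #(s \ e) := card_image_le
      _ = #s - #e := card_sdiff_of_subset hes
      _ ≤ #s + 1 - k := by omega

/-- Iterated local LYM: for a `k`-uniform family inside `s` and `t ≤ k ≤ #s`,
`#𝒜 · k(k-1)⋯(k-t+1) ≤ #∂^[t]𝒜 · (#s-k+t)(#s-k+t-1)⋯(#s-k+1)`. [folklore] -/
private theorem card_mul_descFactorial_le {s : Finset α} (t : ℕ) : ∀ (k : ℕ) (𝒜 : Finset (Finset α)),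
    (∀ a ∈ 𝒜, a ⊆ s) → (𝒜 : Set (Finset α)).Sized k → t ≤ k → k ≤ #s →
    #𝒜 * k.descFactorial t ≤ #(∂^[t] 𝒜) * (#s - k + t).descFactorial t := by
  induction t with
  | zero => intro k 𝒜 _ _ _ _; simp
  | succ t ih =>
    intro k 𝒜 hs hk htk hks
    obtain ⟨k', rfl⟩ : ∃ k', k = k' + 1 := ⟨k - 1, by omega⟩
    have hsh : ∀ a ∈ ∂ 𝒜, a ⊆ s := fun a ha => by
      obtain ⟨b, hb, hab⟩ := exists_subset_of_mem_shadow ha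
      exact hab.trans (hs b hb)
    have hk' : ((∂ 𝒜 : Finset (Finset α)) : Set (Finset α)).Sized k' := by
      simpa using hk.shadow
    have ih' := ih k' (∂ 𝒜) hsh hk' (by omega) (by omega)
    have hL := card_mul_le_card_shadow_mul hs hk
    rw [Function.iterate_succ_apply, Nat.succ_descFactorial_succ,
      show #s - (k' + 1) + (t + 1) = (#s - k' + t) by omega, Nat.descFactorial_succ,
      show #s - k' + t - t = #s - k' by omega]
    calc #𝒜 * ((k' + 1) * k'.descFactorial t) = (#𝒜 * (k' + 1)) * k'.descFactorial t := by ring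
      _ ≤ (#(∂ 𝒜) * (#s + 1 - (k' + 1))) * k'.descFactorial t := Nat.mul_le_mul_right _ hL
      _ = (#s - k') * (#(∂ 𝒜) * k'.descFactorial t) := by
          rw [show #s + 1 - (k' + 1) = #s - k' by omega]; ring
      _ ≤ (#s - k') * (#(∂^[t] (∂ 𝒜)) * (#s - k' + t).descFactorial t) := Nat.mul_le_mul_left _ ih'
      _ = #(∂^[t] (∂ 𝒜)) * ((#s - k') * (#s - k' + t).descFactorial t) := by ring

/-! ### The induction -/

/-- Katona's `t`-intersecting shadow theorem relative to a ground finset of size `n` (the induction statement).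
[cite: Katona1964, Theorem 1] -/
private theorem card_le_card_shadow_iterate_aux (t n : ℕ) : ∀ (s : Finset α), #s = n →
    ∀ (k : ℕ) (𝒜 : Finset (Finset α)), (∀ a ∈ 𝒜, a ⊆ s) → (𝒜 : Set (Finset α)).Sized k →
      (∀ a ∈ 𝒜, ∀ b ∈ 𝒜, t ≤ #(a ∩ b)) → #𝒜 ≤ #(∂^[t] 𝒜) := by
  induction n using Nat.strong_induction_on with
  | _ n ih =>
  intro s hsn k 𝒜 hs hk hI
  rcases 𝒜.eq_empty_or_nonempty with rfl | hne
  · simp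
  obtain ⟨a₀, ha₀⟩ := hne
  have htk : t ≤ k := by have := hI a₀ ha₀ a₀ ha₀; rwa [inter_self, hk ha₀] at this
  have hks : k ≤ #s := by rw [← hk ha₀]; exact card_le_card (hs a₀ ha₀)
  by_cases h2k : #s + t ≤ 2 * k
  · -- few points: iterated local LYM, and `k ≥ #s - k + t`
    have h := card_mul_descFactorial_le t k 𝒜 hs hk htk hks
    have hmono : (#s - k + t).descFactorial t ≤ k.descFactorial t := Nat.descFactorial_le t (by omega)
    have hpos : 0 < k.descFactorial t := Nat.descFactorial_pos.2 htk
    exact Nat.le_of_mul_le_mul_right (h.trans (Nat.mul_le_mul_left _ hmono)) hpos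
  · -- many points: shift, split along `ℓ`, induct
    have h2k' : 2 * k + 1 ≤ #s + t := by omega
    obtain ⟨ℓ, hℓ⟩ : s.Nonempty := card_pos.1 (by omega)
    obtain ⟨ℬ, hℬs, hℬcard, hℬk, hℬI, hℬsh, hℬc⟩ := exists_compressed s ℓ k t _ 𝒜 le_rfl hs hk hI
    set ℬ₀ := ℬ.filter fun b => ℓ ∉ b with hℬ₀
    set ℬ₁ := (ℬ.filter fun b => ℓ ∈ b).image fun b => b.erase ℓ with hℬ₁
    have hlt : #(s.erase ℓ) < n := by
      rw [card_erase_of_mem hℓ, hsn]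
      have : 0 < n := hsn ▸ card_pos.2 ⟨ℓ, hℓ⟩
      omega
    have hℬ₀s : ∀ b ∈ ℬ₀, b ⊆ s.erase ℓ := fun b hb x hx =>
      mem_erase.2 ⟨fun h => (mem_filter.1 hb).2 (h ▸ hx), hℬs b (mem_filter.1 hb).1 hx⟩
    have hℬ₁s : ∀ b ∈ ℬ₁, b ⊆ s.erase ℓ := fun b hb x hx => by
      obtain ⟨c, hc, rfl⟩ := mem_image.1 hb
      exact mem_erase.2 ⟨(mem_erase.1 hx).1, hℬs c (mem_filter.1 hc).1 (mem_erase.1 hx).2⟩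
    have hℬ₀k : (ℬ₀ : Set (Finset α)).Sized k := fun b hb => hℬk (mem_filter.1 (show b ∈ ℬ₀ from hb)).1
    have hℬ₁k : (ℬ₁ : Set (Finset α)).Sized (k - 1) := by
      intro b hb
      obtain ⟨c, hc, rfl⟩ := mem_image.1 (show b ∈ ℬ₁ from hb)
      rw [card_erase_of_mem (mem_filter.1 hc).2, hℬk (mem_filter.1 hc).1]
    have hℬ₀I : ∀ a ∈ ℬ₀, ∀ b ∈ ℬ₀, t ≤ #(a ∩ b) :=
      fun a ha b hb => hℬI a (mem_filter.1 ha).1 b (mem_filter.1 hb).1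
    have hℬ₁I : ∀ a ∈ ℬ₁, ∀ b ∈ ℬ₁, t ≤ #(a ∩ b) := le_card_inter_image_erase_of_isCompressed hℬk hℬI hℬc h2k'
    have h0 : #ℬ₀ ≤ #(∂^[t] ℬ₀) := ih _ hlt (s.erase ℓ) rfl k ℬ₀ hℬ₀s hℬ₀k hℬ₀I
    have h1 : #ℬ₁ ≤ #(∂^[t] ℬ₁) := ih _ hlt (s.erase ℓ) rfl (k - 1) ℬ₁ hℬ₁s hℬ₁k hℬ₁I
    calc #𝒜 = #ℬ := hℬcard.symm
      _ = #ℬ₀ + #ℬ₁ := card_split ℬ ℓ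
      _ ≤ #(∂^[t] ℬ₀) + #(∂^[t] ℬ₁) := add_le_add h0 h1
      _ ≤ #(∂^[t] ℬ) := card_shadow_iterate_split ℬ ℓ t
      _ ≤ #(∂^[t] 𝒜) := hℬsh

end KatonaShadowT

/-- **Katona's intersecting shadow theorem, `t`-intersecting form** (Katona 1964, Theorem 1 at `g = k - t`): if
`𝒜` is a finite family of `k`-element sets any two of which have at least `t` common elements, then the `t`-fold shadow
`∂^[t] 𝒜` (the `(k-t)`-element subsets of members of `𝒜`) has at least `#𝒜` members.  Equality holds for all
`k`-subsets of a `(2k-t)`-set.  For `t = 1` this is `card_le_card_shadow_of_sized_of_intersecting`.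
[cite: Katona1964, Theorem 1] -/
theorem card_le_card_shadow_iterate_of_sized_of_le_card_inter {k t : ℕ} {𝒜 : Finset (Finset α)}
    (hk : (𝒜 : Set (Finset α)).Sized k) (hI : ∀ a ∈ 𝒜, ∀ b ∈ 𝒜, t ≤ #(a ∩ b)) :
    #𝒜 ≤ #(∂^[t] 𝒜) :=
  KatonaShadowT.card_le_card_shadow_iterate_aux t _ (𝒜.biUnion id) rfl k 𝒜
    (fun a ha => by simpa using subset_biUnion_of_mem id ha) hk hI

end Literature.Combinatorics.SetFamily
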